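import Literature.NumberTheory.BeurlingPrimes.PsiZeroFree
import Mathlib.MeasureTheory.Integral.CurveIntegral.Poincare
import HarnessLib

/-!
# The continuation of `ζ_P` from `ψ_P(x) = x + O(x^{α+ε})` alone: discharge of `HilberdinkLapidus2006_thm21`

Topic `Literature/NumberTheory/BeurlingPrimes`. Everything in this file is PROVED; it DISCHARGES the
named fact `Literature.NumberTheory.BeurlingPrimes.HilberdinkLapidus2006_thm21` of
`WellBehavedIntegers.lean` (`HilberdinkLapidus2006_thm21_holds`).

Hilberdink–Lapidus 2006, Theorem 2.1 (first half): "Suppose that for some `α ∈ [0,1)`, we have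
`ψ(x) = x + O(x^{α+ε})` for all `ε > 0`. Then `ζ(s)` has an analytic continuation to the half-plane
`{s ∈ ℂ : Re s > α}` except for a simple (non-removable) pole at `s = 1` and `ζ(s) ≠ 0` in this
region." Printed proof: "By hypothesis, `ψ(x) = x + r(x)` where `r(x) = O(x^{α+ε})` for all
`ε > 0`. It follows that `φ(s) = s∫₁^∞ (x + r(x))x^{−s−1} dx = s/(s−1) + s∫₁^∞ r(x)x^{−s−1} dx`. The
latter integral converges for `Re s > α` and represents an analytic function in this half-plane.
This provides the analytic continuation of `φ(s)` to `{Re s > α}` except for a simple pole at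
`s = 1` with residue 1. By standard complex analysis, it follows that `ζ(s)` has an analytic
continuation to `{Re s > α} ∖ {1}`, except for a simple (non-removable) pole at 1. Moreover, it has
no zeros in this region, for if it did, then `φ(s) = ζ'(s)/ζ(s)` would have a singularity."

The "standard complex analysis" is made explicit as follows (the tree's `HilberdinkNonvanishing.lean`
and `PsiZeroFree.lean` prove the zero-freeness only for systems whose INTEGERS are also regular,
taking the continuation of `ζ_P` from `N_P(x) = ρx + O(x^β)`; here nothing is assumed on `N_P`):

* §1 `Hilberdink.summable_prime_rpow_of_chebyshevPsi_le` — from `ψ_P(x) ≤ Ax` alone,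
  `(j+1) log λ₀ ≤ ∑_{i ≤ j} log λ_i ≤ ψ_P(λ_j) ≤ Aλ_j`, so `∑_j λ_j^{−σ} < ∞` for `σ > 1` (hence the
  series and Euler product of `ζ_P` converge absolutely there, tree `EulerProduct.lean`);
* §2 the tree's chain `φ(s) = s∫₁^∞ ψ_P x^{−s−1} dx`, `s∫₁^∞ r(x)x^{−s−1} dx = φ(s) − s/(s−1)`,
  `L' = −φ` for the Euler logarithm `L` (`HilberdinkLogDeriv.lean`, stated there under `N_P(x) ≤ Bx`)
  re-derived VERBATIM under the summability hypothesis `∀ σ > 1, ∑_j λ_j^{−σ} < ∞` only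
  (`…_of_summable`); a bound `N_P(x) ≤ Bx` does not follow cheaply from the hypothesis on `ψ_P`;
* §3 `E(s) = 1 + s∫₁^∞ r(x)x^{−s−1} dx = φ(s) − 1/(s−1)` (`r = ψ_P − x`), holomorphic on
  `H = {Re s > α}` (all `ε > 0` at once); a primitive `G` of it on the CONVEX set `H` (Mathlib's
  Poincaré lemma `Convex.exists_forall_hasDerivWithinAt`); the continuation
  `Z(s) = K e^{−G(s)}/(s − 1)`, `K = ζ_P(2)e^{G(2)} ≠ 0`, which satisfies `Z' = −φZ` on `H ∖ {1}`;
  on `Re s > 1` so does `ζ_P = e^{L}`, and `W = Z − ζ_P`, `W' = −φW`, `W(2) = 0` force `W ≡ 0`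
  (tree `eqOn_zero_of_deriv_eq_neg_mul`, `PsiZeroFree.lean`). `Z` is zero-free and
  `(s − 1)Z(s) = Ke^{−G(s)} → Ke^{−G(1)} ≠ 0`: the pole at `1` is simple and non-removable.

## References
* [HilberdinkLapidus2006] T. W. Hilberdink, M. L. Lapidus, *Beurling zeta functions, generalised
  primes, and fractal membranes*, Acta Appl. Math. 94 (2006) 21–48, arXiv:math/0410270, §2.1,
  Theorem 2.1 (first half) and its proof (read: arXiv version pp. 4–5).
-/

noncomputable section

open Set Filter MeasureTheory Complex
open scoped Topology

namespace Literature.NumberTheory.BeurlingPrimes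

open Literature.Barriers.RiemannHypothesis

namespace Hilberdink

/-! ### §1 Convergence of `∑_j λ_j^{−σ}` from `ψ_P(x) ≤ Ax` -/

section summability

variable (P : BeurlingPrimes)

/-- `∑_{i ≤ j} log λ_i ≤ ψ_P(λ_j)` (the terms `(i, 0)`, `i ≤ j`, of the finite sum `ψ_P`). [folklore] -/
theorem sum_log_prime_le_chebyshevPsi (j : ℕ) :
    ∑ i ∈ Finset.range (j + 1), Real.log (P.prime i) ≤ P.chebyshevPsi (P.prime j) := by
  classical
  rw [P.chebyshevPsi_eq_tsum]
  have hinj : Function.Injective fun i : ℕ ↦ ((i, 0) : ℕ × ℕ) := fun a b h ↦ by simpa using h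
  calc ∑ i ∈ Finset.range (j + 1), Real.log (P.prime i)
      = ∑ jk ∈ (Finset.range (j + 1)).map ⟨_, hinj⟩, P.psiTerm (P.prime j) jk := by
        rw [Finset.sum_map]
        refine Finset.sum_congr rfl fun i hi ↦ ?_
        simp only [Function.Embedding.coeFn_mk, BeurlingPrimes.psiTerm, zero_add, pow_one]
        rw [if_pos (P.mono (Nat.lt_succ_iff.mp (Finset.mem_range.mp hi)))]
    _ ≤ ∑' jk, P.psiTerm (P.prime j) jk :=
        (P.summable_psiTerm _).sum_le_tsum _ fun jk _ ↦ P.psiTerm_nonneg _ jk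

/-- `(j + 1) log λ₀ ≤ ψ_P(λ_j)`. [folklore] -/
theorem succ_mul_log_le_chebyshevPsi (j : ℕ) :
    ((j : ℝ) + 1) * Real.log (P.prime 0) ≤ P.chebyshevPsi (P.prime j) := by
  refine le_trans ?_ (sum_log_prime_le_chebyshevPsi P j)
  calc ((j : ℝ) + 1) * Real.log (P.prime 0)
      = ∑ _i ∈ Finset.range (j + 1), Real.log (P.prime 0) := by
        rw [Finset.sum_const, Finset.card_range, nsmul_eq_mul]; push_cast; ring
    _ ≤ ∑ i ∈ Finset.range (j + 1), Real.log (P.prime i) :=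
        Finset.sum_le_sum fun i _ ↦ Real.log_le_log (P.prime_pos 0) (P.mono (Nat.zero_le i))

/-- **`∑_j λ_j^{−σ} < ∞` for `σ > 1` when `ψ_P(x) ≤ Ax`** (`x ≥ 1`): `(j+1) log λ₀ ≤ Aλ_j`, compare
with `∑ (j+1)^{−σ}`. [cite: HilberdinkLapidus2006, §1.1] -/
theorem summable_prime_rpow_of_chebyshevPsi_le {A : ℝ}
    (hA : ∀ x : ℝ, 1 ≤ x → P.chebyshevPsi x ≤ A * x) {σ : ℝ} (hσ : 1 < σ) :
    Summable fun j ↦ P.prime j ^ (-σ) := by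
  have hlog : 0 < Real.log (P.prime 0) := Real.log_pos P.one_lt
  set B : ℝ := A / Real.log (P.prime 0) with hBdef
  have hle : ∀ j : ℕ, (j : ℝ) + 1 ≤ B * P.prime j := by
    intro j
    have h1 := succ_mul_log_le_chebyshevPsi P j
    have h2 := hA (P.prime j) (P.one_lt_prime j).le
    rw [hBdef, div_mul_eq_mul_div, le_div_iff₀ hlog]
    linarith
  have hB0 : 0 < B := by
    have h := hle 0
    simp only [Nat.cast_zero, zero_add] at h
    by_contra hB0
    have : B * P.prime 0 ≤ 0 := mul_nonpos_of_nonpos_of_nonneg (not_lt.mp hB0) (P.prime_pos 0).le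
    linarith
  have hp : Summable fun j : ℕ ↦ B ^ σ * ((j : ℝ) + 1) ^ (-σ) := by
    have h := (Real.summable_nat_rpow (p := -σ)).mpr (by linarith)
    have h' : Summable fun j : ℕ ↦ ((j + 1 : ℕ) : ℝ) ^ (-σ) := (summable_nat_add_iff 1).mpr h
    refine (h'.mul_left (B ^ σ)).congr fun j ↦ ?_
    push_cast; ring_nf
  refine Summable.of_nonneg_of_le (fun j ↦ Real.rpow_nonneg (P.prime_pos j).le _) (fun j ↦ ?_) hp
  have hj : (0 : ℝ) < (j : ℝ) + 1 := by positivity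
  have h1 : ((j : ℝ) + 1) / B ≤ P.prime j := by
    rw [div_le_iff₀ hB0]; linarith [hle j]
  calc P.prime j ^ (-σ) ≤ (((j : ℝ) + 1) / B) ^ (-σ) :=
        Real.rpow_le_rpow_of_nonpos (by positivity) h1 (by linarith)
    _ = B ^ σ * ((j : ℝ) + 1) ^ (-σ) := by
        rw [Real.div_rpow hj.le hB0.le, Real.rpow_neg hB0.le, div_inv_eq_mul, mul_comm]

variable {P}

/-- From `|ψ_P(x) − x| ≤ Cx^θ` (`x ≥ 1`, `θ ≤ 1`): `ψ_P(x) ≤ (1 + C)x`. [folklore] -/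
theorem chebyshevPsi_le_of_abs_le {C θ : ℝ} (hθ : θ ≤ 1)
    (hψ : ∀ x : ℝ, 1 ≤ x → |P.chebyshevPsi x - x| ≤ C * x ^ θ) :
    ∀ x : ℝ, 1 ≤ x → P.chebyshevPsi x ≤ (1 + C) * x := by
  intro x hx
  have hxθ : x ^ θ ≤ x := by
    calc x ^ θ ≤ x ^ (1 : ℝ) := Real.rpow_le_rpow_of_exponent_le hx hθ
      _ = x := Real.rpow_one x
  have := (abs_le.mp (hψ x hx)).2
  have hC := nonneg_of_abs_le_mul_rpow hψ
  nlinarith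

end summability

/-! ### §2 The chain `φ = s∫ψ_P x^{−s−1}`, `L' = −φ` under `∑_j λ_j^{−σ} < ∞` only -/

section chain

variable {P : BeurlingPrimes} (hP : ∀ σ : ℝ, 1 < σ → Summable fun j ↦ P.prime j ^ (-σ))
include hP

/-- `∑_{(j,m)} log λ_j · λ_j^{−(m+1)σ} < ∞` for `σ > 1` (the tree's `summable_primePow_rpow`, from
summability of `∑ λ_j^{−σ'}`, `σ' > 1`, alone). [folklore] -/
theorem summable_primePow_rpow_of_summable {σ : ℝ} (hσ : 1 < σ) :
    Summable fun jm : ℕ × ℕ ↦ Real.log (P.prime jm.1) * P.prime jm.1 ^ (-((jm.2 + 1 : ℕ) * σ)) := by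
  have hnn : 0 ≤ fun jm : ℕ × ℕ ↦ Real.log (P.prime jm.1) * P.prime jm.1 ^ (-((jm.2 + 1 : ℕ) * σ)) :=
    fun jm ↦ mul_nonneg (Real.log_pos (P.one_lt_prime _)).le (Real.rpow_nonneg (P.prime_pos _).le _)
  rw [summable_prod_of_nonneg hnn]
  set q₀ : ℝ := P.prime 0 ^ (-σ) with hq₀
  have hq₀1 : q₀ < 1 := Real.rpow_lt_one_of_one_lt_of_neg P.one_lt (by linarith)
  have hq : ∀ j, P.prime j ^ (-σ) ≤ q₀ := fun j ↦
    Real.rpow_le_rpow_of_nonpos (P.prime_pos 0) (P.mono (Nat.zero_le j)) (by linarith)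
  have hqpos : ∀ j, 0 < P.prime j ^ (-σ) := fun j ↦ Real.rpow_pos_of_pos (P.prime_pos j) _
  have hterm : ∀ j m, P.prime j ^ (-((m + 1 : ℕ) * σ)) = P.prime j ^ (-σ) * (P.prime j ^ (-σ)) ^ m := by
    intro j m
    rw [← Real.rpow_natCast, ← Real.rpow_mul (P.prime_pos j).le, ← Real.rpow_add (P.prime_pos j)]
    congr 1; push_cast; ring
  have hgeom : ∀ j, HasSum (fun m : ℕ ↦ Real.log (P.prime j) * P.prime j ^ (-((m + 1 : ℕ) * σ)))
      (Real.log (P.prime j) * (P.prime j ^ (-σ) * (1 - P.prime j ^ (-σ))⁻¹)) := by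
    intro j
    simp_rw [hterm j]
    refine HasSum.mul_left _ (HasSum.mul_left _ ?_)
    exact hasSum_geometric_of_lt_one (hqpos j).le ((hq j).trans_lt hq₀1)
  refine ⟨fun j ↦ (hgeom j).summable, ?_⟩
  simp_rw [fun j ↦ (hgeom j).tsum_eq]
  set η : ℝ := (σ - 1) / 2 with hη
  have hη0 : 0 < η := by rw [hη]; linarith
  have hs := hP (σ - η) (by rw [hη]; linarith)
  refine Summable.of_nonneg_of_le (fun j ↦ ?_) (fun j ↦ ?_) ((hs.mul_left (η⁻¹ * (1 - q₀)⁻¹)))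
  · exact mul_nonneg (Real.log_pos (P.one_lt_prime j)).le
      (mul_nonneg (hqpos j).le (inv_nonneg.mpr (by linarith [hq j])))
  · have hlog : Real.log (P.prime j) ≤ P.prime j ^ η / η := Real.log_le_rpow_div (P.prime_pos j).le hη0
    have h1 : (1 - P.prime j ^ (-σ))⁻¹ ≤ (1 - q₀)⁻¹ :=
      inv_anti₀ (by linarith) (by linarith [hq j])
    have hpow : P.prime j ^ η * P.prime j ^ (-σ) = P.prime j ^ (-(σ - η)) := by
      rw [← Real.rpow_add (P.prime_pos j)]; congr 1; ring
    have hA : P.prime j ^ (-σ) * (1 - P.prime j ^ (-σ))⁻¹ ≤ P.prime j ^ (-σ) * (1 - q₀)⁻¹ :=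
      mul_le_mul_of_nonneg_left h1 (hqpos j).le
    have hB' : 0 ≤ P.prime j ^ (-σ) * (1 - P.prime j ^ (-σ))⁻¹ :=
      mul_nonneg (hqpos j).le (inv_nonneg.mpr (by linarith [hq j]))
    have hC : 0 ≤ P.prime j ^ η / η := div_nonneg (Real.rpow_nonneg (P.prime_pos j).le _) hη0.le
    calc Real.log (P.prime j) * (P.prime j ^ (-σ) * (1 - P.prime j ^ (-σ))⁻¹)
        ≤ (P.prime j ^ η / η) * (P.prime j ^ (-σ) * (1 - q₀)⁻¹) := mul_le_mul hlog hA hB' hC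
      _ = η⁻¹ * (1 - q₀)⁻¹ * P.prime j ^ (-(σ - η)) := by rw [← hpow]; ring

/-- Absolute convergence of the von Mangoldt series for `Re s > 1`. [folklore] -/
theorem summable_norm_vonMangoldt_term_of_summable {s : ℂ} (hs : 1 < s.re) :
    Summable fun jm : ℕ × ℕ ↦
      ‖(Real.log (P.prime jm.1) : ℂ) * ((P.prime jm.1 ^ (jm.2 + 1) : ℝ) : ℂ) ^ (-s)‖ := by
  simp_rw [norm_vonMangoldt_term]
  exact summable_primePow_rpow_of_summable hP hs

/-- **`φ(s) = s ∫₁^∞ ψ_P(x) x^{−s−1} dx` for `Re s > 1`** (the tree's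
`vonMangoldtSeries_eq_mul_integral`, under summability only). [cite: HilberdinkLapidus2006, §2.1] -/
theorem vonMangoldtSeries_eq_mul_integral_of_summable {s : ℂ} (hs : 1 < s.re) :
    vonMangoldtSeries P s = s * ∫ x in Ioi (1 : ℝ), (P.chebyshevPsi x : ℂ) * (x : ℂ) ^ (-s - 1) := by
  have hs0 : 0 < s.re := by linarith
  have hsum : Summable fun jm : ℕ × ℕ ↦
      ‖(Real.log (P.prime jm.1) : ℂ)‖ * (P.prime jm.1 ^ (jm.2 + 1)) ^ (-s.re) := by
    refine (summable_primePow_rpow_of_summable hP hs).congr fun jm ↦ ?_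
    have he : ((jm.2 + 1 : ℕ) : ℝ) * -s.re = -((jm.2 + 1 : ℕ) * s.re) := by ring
    rw [Complex.norm_real, Real.norm_eq_abs, abs_of_pos (Real.log_pos (P.one_lt_prime _)),
      ← Real.rpow_natCast, ← Real.rpow_mul (P.prime_pos _).le, he]
  have hA : ∀ x : ℝ, HasSum (fun jm : ℕ × ℕ ↦ if P.prime jm.1 ^ (jm.2 + 1) ≤ x
      then (Real.log (P.prime jm.1) : ℂ) else 0) (P.chebyshevPsi x : ℂ) := by
    intro x
    have h := Complex.hasSum_ofReal.mpr (P.summable_psiTerm x).hasSum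
    rw [← P.chebyshevPsi_eq_tsum] at h
    have hfun : (fun jm : ℕ × ℕ ↦ if P.prime jm.1 ^ (jm.2 + 1) ≤ x
        then (Real.log (P.prime jm.1) : ℂ) else 0) = fun jm ↦ (P.psiTerm x jm : ℂ) := by
      funext jm
      unfold BeurlingPrimes.psiTerm
      split_ifs <;> simp
    rw [hfun]
    exact h
  have h := mul_setIntegral_counting_eq_tsum (v := fun jm : ℕ × ℕ ↦ P.prime jm.1 ^ (jm.2 + 1))
    (w := fun jm : ℕ × ℕ ↦ (Real.log (P.prime jm.1) : ℂ))
    (fun jm ↦ one_le_pow₀ (P.one_lt_prime jm.1).le) hs0 hsum hA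
  rw [h]
  rfl

/-- **`s · ∫₁^∞ r(x) x^{−s−1} dx = φ(s) − s/(s−1)` for `Re s > 1`** (`r = ψ_P − x`; the tree's
`mul_mellin_errPsi_eq`, under summability only). [cite: HilberdinkLapidus2006, proof of Thm 2.1] -/
theorem mul_mellin_errPsi_eq_of_summable {C θ : ℝ} (hθ : θ ≤ 1)
    (hψ : ∀ x : ℝ, 1 ≤ x → |P.chebyshevPsi x - x| ≤ C * x ^ θ) {s : ℂ} (hs : 1 < s.re) :
    s * mellin (errPsi P) (-s) = vonMangoldtSeries P s - s / (s - 1) := by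
  rw [mellin_errPsi_eq_setIntegral, vonMangoldtSeries_eq_mul_integral_of_summable hP hs]
  have h1 := integrableOn_chebyshevPsi_mul_cpow hθ hψ hs
  have h2 : IntegrableOn (fun x : ℝ ↦ (x : ℂ) * (x : ℂ) ^ (-s - 1)) (Ioi 1) := by
    have h : ∀ x ∈ Ioi (1 : ℝ), (x : ℂ) ^ (-s) = (x : ℂ) * (x : ℂ) ^ (-s - 1) := by
      intro x hx
      have hx0 : (x : ℂ) ≠ 0 := ofReal_ne_zero.mpr (zero_lt_one.trans hx).ne'
      symm
      calc (x : ℂ) * (x : ℂ) ^ (-s - 1) = (x : ℂ) ^ (1 : ℂ) * (x : ℂ) ^ (-s - 1) := by rw [cpow_one]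
        _ = (x : ℂ) ^ ((1 : ℂ) + (-s - 1)) := (cpow_add _ _ hx0).symm
        _ = (x : ℂ) ^ (-s) := by ring_nf
    exact (integrableOn_Ioi_cpow_of_lt (by simp; linarith) zero_lt_one).congr_fun h measurableSet_Ioi
  have hsplit : ∀ x : ℝ, ((P.chebyshevPsi x - x : ℝ) : ℂ) * (x : ℂ) ^ (-s - 1) =
      (P.chebyshevPsi x : ℂ) * (x : ℂ) ^ (-s - 1) - (x : ℂ) * (x : ℂ) ^ (-s - 1) := by
    intro x; push_cast; ring
  simp_rw [hsplit]
  rw [integral_sub h1 h2, setIntegral_mul_cpow_eq hs]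
  have hs1 : s - 1 ≠ 0 := by
    intro h0; have := congrArg Complex.re h0; simp at this; linarith
  field_simp

/-- `∑_j log λ_j · λ_j^{−σ₀} < ∞` for `σ₀ > 1`. [folklore] -/
theorem summable_log_mul_prime_rpow_of_summable {σ₀ : ℝ} (hσ₀ : 1 < σ₀) :
    Summable fun j ↦ Real.log (P.prime j) * P.prime j ^ (-σ₀) := by
  have h := (summable_primePow_rpow_of_summable hP hσ₀).comp_injective
    (show Function.Injective fun j : ℕ ↦ (j, 0) from fun a b hab ↦ by simpa using hab)
  refine h.congr fun j ↦ ?_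
  simp

/-- **`L` is holomorphic on `Re s > 1` and `L'(s) = −φ(s)`** (the tree's `hasDerivAt_eulerLog`,
under summability only: termwise differentiation and the geometric series in `m`).
[cite: HilberdinkLapidus2006, §2.1] -/
theorem hasDerivAt_eulerLog_of_summable {s : ℂ} (hs : 1 < s.re) :
    DifferentiableAt ℂ (eulerLog P) s ∧ deriv (eulerLog P) s = -vonMangoldtSeries P s := by
  set σ₀ : ℝ := (1 + s.re) / 2 with hσ₀def
  have hσ₀ : 1 < σ₀ := by rw [hσ₀def]; linarith
  have hσ₀s : σ₀ < s.re := by rw [hσ₀def]; linarith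
  have hσ₀0 : 0 < σ₀ := by linarith
  set U : Set ℂ := {w : ℂ | σ₀ < w.re} with hU
  have hUo : IsOpen U := isOpen_lt continuous_const Complex.continuous_re
  have hsU : s ∈ U := hσ₀s
  have hq₀ : P.prime 0 ^ (-σ₀) < 1 := (prime_rpow_le_q₀ (P := P) hσ₀0 0).2
  have hF_le : ∀ (j : ℕ) (w : ℂ), w ∈ U → ‖eulerLogTerm P j w‖ ≤
      (1 + (1 - P.prime 0 ^ (-σ₀))⁻¹ / 2) * P.prime j ^ (-σ₀) :=
    fun j w hw ↦ norm_eulerLogTerm_le hσ₀0 (le_of_lt hw) j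
  have hu : Summable fun j ↦ (1 + (1 - P.prime 0 ^ (-σ₀))⁻¹ / 2) * P.prime j ^ (-σ₀) :=
    (hP σ₀ hσ₀).mul_left _
  have hf : ∀ j, DifferentiableOn ℂ (eulerLogTerm P j) U := fun j w hw ↦
    (hasDerivAt_eulerLogTerm (hσ₀0.trans hw) j).differentiableAt.differentiableWithinAt
  have hdiff : DifferentiableOn ℂ (fun w ↦ ∑' j, eulerLogTerm P j w) U :=
    Complex.differentiableOn_tsum_of_summable_norm hu hf hUo hF_le
  have hderiv := Complex.hasSum_deriv_of_summable_norm hu hf hUo hF_le hsU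
  have hfun : eulerLog P = fun w ↦ ∑' j, eulerLogTerm P j w := rfl
  refine ⟨?_, ?_⟩
  · rw [hfun]; exact hdiff.differentiableAt (hUo.mem_nhds hsU)
  · rw [hfun]
    refine (hderiv.unique ?_)
    have hs0 : 0 < s.re := by linarith
    have hderj : ∀ j, deriv (eulerLogTerm P j) s =
        -(Real.log (P.prime j) : ℂ) * ((P.prime j : ℝ) : ℂ) ^ (-s) / (1 - ((P.prime j : ℝ) : ℂ) ^ (-s)) :=
      fun j ↦ (hasDerivAt_eulerLogTerm hs0 j).deriv
    simp_rw [hderj]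
    have hsumm := (summable_norm_vonMangoldt_term_of_summable hP hs)
    have hprod := hsumm.of_norm
    have hgeo : ∀ j, HasSum (fun m : ℕ ↦ (Real.log (P.prime j) : ℂ) * ((P.prime j ^ (m + 1) : ℝ) : ℂ) ^ (-s))
        ((Real.log (P.prime j) : ℂ) * ((P.prime j : ℝ) : ℂ) ^ (-s) / (1 - ((P.prime j : ℝ) : ℂ) ^ (-s))) := by
      intro j
      set w : ℂ := ((P.prime j : ℝ) : ℂ) ^ (-s) with hw
      have hw1 : ‖w‖ < 1 := by
        rw [hw, norm_cpow_eq_rpow_re_of_pos (P.prime_pos j), neg_re]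
        exact Real.rpow_lt_one_of_one_lt_of_neg (P.one_lt_prime j) (by linarith)
      have hlam : (0 : ℝ) < P.prime j := P.prime_pos j
      have hterm : ∀ m : ℕ, ((P.prime j ^ (m + 1) : ℝ) : ℂ) ^ (-s) = w * w ^ m := by
        intro m
        rw [← pow_succ', hw, cpow_def_of_ne_zero (ofReal_ne_zero.mpr (pow_pos hlam _).ne'),
          cpow_def_of_ne_zero (ofReal_ne_zero.mpr hlam.ne'), ← Complex.exp_nat_mul,
          ← Complex.ofReal_log (pow_pos hlam _).le, ← Complex.ofReal_log hlam.le, Real.log_pow]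
        congr 1
        push_cast
        ring
      have hg := (hasSum_geometric_of_norm_lt_one hw1).mul_left ((Real.log (P.prime j) : ℂ) * w)
      have hfun : (fun m : ℕ ↦ (Real.log (P.prime j) : ℂ) * ((P.prime j ^ (m + 1) : ℝ) : ℂ) ^ (-s)) =
          fun m ↦ (Real.log (P.prime j) : ℂ) * w * w ^ m := by
        funext m; rw [hterm m]; ring
      have hval : (Real.log (P.prime j) : ℂ) * w / (1 - w) = (Real.log (P.prime j) : ℂ) * w * (1 - w)⁻¹ :=
        div_eq_mul_inv _ _
      rw [hfun, hval]
      exact hg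
    have h2 := hprod.tsum_prod' (fun j ↦ (hgeo j).summable)
    have hneg : -vonMangoldtSeries P s = ∑' j, -((Real.log (P.prime j) : ℂ) * ((P.prime j : ℝ) : ℂ) ^ (-s) /
        (1 - ((P.prime j : ℝ) : ℂ) ^ (-s))) := by
      rw [tsum_neg, vonMangoldtSeries, h2]
      congr 1
      exact tsum_congr fun j ↦ (hgeo j).tsum_eq
    rw [hneg]
    refine (Summable.hasSum ?_).congr_fun fun j ↦ by ring
    refine Summable.neg (Summable.of_norm ?_)
    refine Summable.of_nonneg_of_le (fun j ↦ norm_nonneg _) (fun j ↦ ?_)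
      ((summable_log_mul_prime_rpow_of_summable hP hσ₀).div_const (1 - P.prime 0 ^ (-σ₀)))
    have := norm_deriv_eulerLogTerm_le (P := P) hσ₀0 hσ₀s.le j
    rw [norm_div, norm_mul, norm_neg] at this
    rw [norm_div, norm_mul]
    exact this

/-- **`ζ_P' = −φ ζ_P` on `Re s > 1`**, for `ζ_P = exp ∘ L`. [cite: HilberdinkLapidus2006, §2.1] -/
theorem hasDerivAt_exp_eulerLog_of_summable {s : ℂ} (hs : 1 < s.re) :
    HasDerivAt (fun w ↦ Complex.exp (eulerLog P w))
      (-(vonMangoldtSeries P s * Complex.exp (eulerLog P s))) s := by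
  obtain ⟨hLd, hLderiv⟩ := hasDerivAt_eulerLog_of_summable hP hs
  refine hLd.hasDerivAt.cexp.congr_deriv ?_
  rw [hLderiv]
  ring

end chain

/-! ### §3 `E(s) = φ(s) − 1/(s − 1) = 1 + s∫₁^∞ r(x)x^{−s−1} dx`, its primitive, and the continuation of `ζ_P` -/

variable {P : BeurlingPrimes}

/-- `E(s) = 1 + s ∫₁^∞ (ψ_P(x) − x) x^{−s−1} dx` ("the latter integral converges for `Re s > α` and
represents an analytic function in this half-plane") is holomorphic on `Re s > α` when
`ψ_P(x) = x + O(x^{α+ε})` for every `ε > 0` (tree: `differentiableOn_mellin_errPsi` on each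
`Re s > α + ε`). [cite: HilberdinkLapidus2006, proof of Thm 2.1] -/
theorem differentiableOn_one_add_mul_mellin_errPsi {α : ℝ}
    (hψ : ∀ ε : ℝ, 0 < ε → ∃ C : ℝ, ∀ x : ℝ, 1 ≤ x → |P.chebyshevPsi x - x| ≤ C * x ^ (α + ε)) :
    DifferentiableOn ℂ (fun s ↦ 1 + s * mellin (errPsi P) (-s)) {s : ℂ | α < s.re} := by
  intro s hs
  have hs' : α < s.re := hs
  have hε : 0 < (s.re - α) / 2 := by linarith
  obtain ⟨C, hC⟩ := hψ _ hε
  have hs'' : α + (s.re - α) / 2 < s.re := by linarith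
  have h : DifferentiableOn ℂ (fun w ↦ 1 + w * mellin (errPsi P) (-w))
      {w : ℂ | α + (s.re - α) / 2 < w.re} :=
    (differentiableOn_const _).add (differentiableOn_id.mul (differentiableOn_mellin_errPsi hC))
  exact (h.differentiableAt
    ((isOpen_lt continuous_const Complex.continuous_re).mem_nhds hs'')).differentiableWithinAt

/-- **`φ(s) = 1/(s − 1) + E(s)` on `Re s > 1`**, `E(s) = 1 + s∫₁^∞ r(x)x^{−s−1} dx` ("`φ(s) = s/(s−1) +
s∫₁^∞ r(x)x^{−s−1} dx`"). [cite: HilberdinkLapidus2006, proof of Thm 2.1] -/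
theorem vonMangoldtSeries_eq_one_div_add (hP : ∀ σ : ℝ, 1 < σ → Summable fun j ↦ P.prime j ^ (-σ))
    {C θ : ℝ} (hθ : θ ≤ 1) (hψ : ∀ x : ℝ, 1 ≤ x → |P.chebyshevPsi x - x| ≤ C * x ^ θ)
    {s : ℂ} (hs : 1 < s.re) :
    vonMangoldtSeries P s = 1 / (s - 1) + (1 + s * mellin (errPsi P) (-s)) := by
  have h := mul_mellin_errPsi_eq_of_summable hP hθ hψ hs
  have hs1 : s - 1 ≠ 0 := by
    intro h0; have := congrArg Complex.re h0; simp at this; linarith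
  rw [h]
  field_simp
  ring

/-- The derivative of `Z(s) = K e^{−G(s)}/(s − 1)`: `Z' = −(1/(s−1) + G'(s)) Z`. [folklore] -/
theorem hasDerivAt_const_mul_exp_neg_div {G : ℂ → ℂ} {E' K s : ℂ} (hG : HasDerivAt G E' s)
    (hs : s ≠ 1) :
    HasDerivAt (fun w ↦ K * Complex.exp (-G w) / (w - 1))
      (-((1 / (s - 1) + E') * (K * Complex.exp (-G s) / (s - 1)))) s := by
  have hs1 : s - 1 ≠ 0 := sub_ne_zero.mpr hs
  have h1 : HasDerivAt (fun w ↦ K * Complex.exp (-G w)) (K * (Complex.exp (-G s) * -E')) s :=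
    hG.neg.cexp.const_mul K
  have h2 : HasDerivAt (fun w : ℂ ↦ w - 1) 1 s := (hasDerivAt_id s).sub_const 1
  refine (h1.div h2 hs1).congr_deriv ?_
  field_simp
  ring

/-- **The continuation of `ζ_P` from `ψ_P(x) = x + O(x^{α+ε})` (`∀ ε > 0`), `α < 1`:** there is
`Z`, holomorphic and zero-free on `{Re s > α} ∖ {1}`, equal to `ζ_P` on `Re s > 1`, with
`(s − 1)Z(s) → c ≠ 0` as `s → 1`. (`Z = Ke^{−G}/(s−1)` for a primitive `G` of `E` on the convex
half-plane and `K = ζ_P(2)e^{G(2)}`; `Z = ζ_P` on `Re s > 1` by uniqueness for `W' = −φW`.)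
[cite: HilberdinkLapidus2006, Thm 2.1] -/
theorem exists_zetaContinuation_of_psi {α : ℝ} (hα : α < 1)
    (hψ : ∀ ε : ℝ, 0 < ε → ∃ C : ℝ, ∀ x : ℝ, 1 ≤ x → |P.chebyshevPsi x - x| ≤ C * x ^ (α + ε)) :
    ∃ Z : ℂ → ℂ, P.IsZetaContinuation α Z ∧
      (∃ c : ℂ, c ≠ 0 ∧ Tendsto (fun s ↦ (s - 1) * Z s) (𝓝[≠] 1) (𝓝 c)) ∧
      ∀ s : ℂ, α < s.re → s ≠ 1 → Z s ≠ 0 := by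
  -- the global bound with exponent `1` (`ε = 1 − α`) and the summability of `∑ λ_j^{−σ}`
  obtain ⟨C₁, hC₁⟩ := hψ (1 - α) (by linarith)
  have hC₁' : ∀ x : ℝ, 1 ≤ x → |P.chebyshevPsi x - x| ≤ C₁ * x ^ (1 : ℝ) := by
    intro x hx
    have := hC₁ x hx
    rwa [show α + (1 - α) = (1 : ℝ) by ring] at this
  have hP : ∀ σ : ℝ, 1 < σ → Summable fun j ↦ P.prime j ^ (-σ) := fun σ hσ ↦
    summable_prime_rpow_of_chebyshevPsi_le P (chebyshevPsi_le_of_abs_le le_rfl hC₁') hσ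
  -- the half-plane `H`, the function `E` and a primitive `G`
  set H : Set ℂ := {s : ℂ | α < s.re} with hHdef
  have hHo : IsOpen H := isOpen_lt continuous_const Complex.continuous_re
  set E : ℂ → ℂ := fun s ↦ 1 + s * mellin (errPsi P) (-s) with hEdef
  have hE : DifferentiableOn ℂ E H := differentiableOn_one_add_mul_mellin_errPsi hψ
  obtain ⟨G, hG'⟩ := (convex_halfSpace_re_gt α).exists_forall_hasDerivWithinAt hE
  have hG : ∀ s ∈ H, HasDerivAt G (E s) s := fun s hs ↦
    (hG' s hs).hasDerivAt (hHo.mem_nhds hs)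
  -- the constant `K` and the continuation `Z`
  have h2re : 1 < (2 : ℂ).re := by norm_num
  have hsum2 : Summable fun j ↦ P.prime j ^ (-(2 : ℂ).re) := by
    rw [Complex.re_ofNat]
    exact hP 2 (by norm_num)
  set K : ℂ := P.zeta 2 * Complex.exp (G 2) with hKdef
  have hK : K ≠ 0 := mul_ne_zero (P.zeta_ne_zero (by norm_num) hsum2) (Complex.exp_ne_zero _)
  set Z : ℂ → ℂ := fun s ↦ K * Complex.exp (-G s) / (s - 1) with hZdef
  have hZd : ∀ s ∈ H, s ≠ 1 → HasDerivAt Z (-((1 / (s - 1) + E s) * Z s)) s :=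
    fun s hs hs1 ↦ hasDerivAt_const_mul_exp_neg_div (hG s hs) hs1
  have hZne : ∀ s : ℂ, s ≠ 1 → Z s ≠ 0 := fun s hs1 ↦
    div_ne_zero (mul_ne_zero hK (Complex.exp_ne_zero _)) (sub_ne_zero.mpr hs1)
  -- `Z = ζ_P` on `V = {Re s > 1}`
  set V : Set ℂ := {s : ℂ | 1 < s.re} with hVdef
  have hVo : IsOpen V := isOpen_lt continuous_const Complex.continuous_re
  have hVH : V ⊆ H := fun s hs ↦ lt_trans hα hs
  have hV1 : ∀ s ∈ V, s ≠ (1 : ℂ) := by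
    intro s hs h
    have hs' : 1 < s.re := hs
    rw [h, one_re] at hs'
    exact lt_irrefl _ hs'
  have h2V : (2 : ℂ) ∈ V := h2re
  set W : ℂ → ℂ := fun s ↦ Z s - Complex.exp (eulerLog P s) with hWdef
  set Φ : ℂ → ℂ := fun s ↦ 1 / (s - 1) + E s with hΦdef
  have hWd' : ∀ s ∈ V, HasDerivAt W (-(Φ s * W s)) s := by
    intro s hs
    have h1 := hZd s (hVH hs) (hV1 s hs)
    have h2 := hasDerivAt_exp_eulerLog_of_summable hP hs
    have h3 : vonMangoldtSeries P s = Φ s := vonMangoldtSeries_eq_one_div_add hP le_rfl hC₁' hs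
    refine (h1.sub h2).congr_deriv ?_
    rw [h3]
    simp only [hWdef, hΦdef]
    ring
  have hWd : DifferentiableOn ℂ W V := fun s hs ↦ (hWd' s hs).differentiableAt.differentiableWithinAt
  have hΦd : DifferentiableOn ℂ Φ V :=
    ((differentiableOn_const _).div (differentiableOn_id.sub (differentiableOn_const _))
      fun s hs ↦ sub_ne_zero.mpr (hV1 s hs)).add (hE.mono hVH)
  have hW2 : W 2 = 0 := by
    have h21 : (2 : ℂ) - 1 = 1 := by norm_num
    simp only [hWdef, hZdef, hKdef]
    rw [show P.zeta 2 = Complex.exp (eulerLog P 2) from P.zeta_eq_exp_tsum (by norm_num) hsum2, h21, div_one, Complex.exp_neg, mul_assoc,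
      mul_inv_cancel₀ (Complex.exp_ne_zero _), mul_one, sub_self]
  have hW0 := eqOn_zero_of_deriv_eq_neg_mul hVo (convex_halfSpace_re_gt 1).isPreconnected hWd hΦd
    (fun z hz ↦ (hWd' z hz).deriv) h2V hW2
  refine ⟨Z, ⟨fun s hs ↦ ?_, fun s hs ↦ (hZd s hs.1 hs.2).differentiableAt.differentiableWithinAt⟩,
    ⟨K * Complex.exp (-G 1), mul_ne_zero hK (Complex.exp_ne_zero _), ?_⟩,
    fun s _ hs1 ↦ hZne s hs1⟩
  · -- agreement with `ζ_P`
    have h := hW0 (show s ∈ V from hs)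
    simp only [hWdef, Pi.zero_apply] at h
    rw [show P.zeta s = Complex.exp (eulerLog P s) from P.zeta_eq_exp_tsum (by linarith) (hP s.re hs)]
    exact sub_eq_zero.mp h
  · -- the simple non-removable pole at `1`
    have h1H : (1 : ℂ) ∈ H := by
      show α < (1 : ℂ).re
      rw [one_re]
      exact hα
    have hcont : ContinuousAt (fun s ↦ K * Complex.exp (-G s)) 1 :=
      ((hG 1 h1H).continuousAt.neg.cexp).const_mul K
    have heq : (fun s ↦ K * Complex.exp (-G s)) =ᶠ[𝓝[≠] (1 : ℂ)] fun s ↦ (s - 1) * Z s := by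
      filter_upwards [self_mem_nhdsWithin] with s hs
      have hs1 : s - 1 ≠ 0 := sub_ne_zero.mpr hs
      simp only [hZdef]
      rw [eq_comm, mul_comm, div_mul_cancel₀ _ hs1]
    exact (hcont.tendsto.mono_left nhdsWithin_le_nhds).congr' heq

end Hilberdink

/-! ### The discharge -/

/-- **Discharge of `HilberdinkLapidus2006_thm21`** (Hilberdink–Lapidus 2006, Theorem 2.1, first
half): `ψ_P(x) = x + O_ε(x^{α+ε})` (`0 ≤ α < 1`) gives a continuation `Z` of `ζ_P` to
`{Re s > α} ∖ {1}` with `(s − 1)Z(s) → c ≠ 0` at `s = 1` and `Z(s) ≠ 0` throughout.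
[cite: HilberdinkLapidus2006, Thm 2.1] -/
theorem HilberdinkLapidus2006_thm21_holds : HilberdinkLapidus2006_thm21 := by
  intro P α _ hα hψ
  exact Hilberdink.exists_zetaContinuation_of_psi hα fun ε hε ↦ hψ ε hε

end Literature.NumberTheory.BeurlingPrimes

end
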